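import Summits.BirchSwinnertonDyer.BirchSwinnertonDyer.Theorems.SylvesterTwoHeegnerIndexCoupledTelescopeBottomLink
import Summits.BirchSwinnertonDyer.BirchSwinnertonDyer.Theorems.SylvesterTwoHeegnerIndexCMHalfBottom
import Summits.BirchSwinnertonDyer.BirchSwinnertonDyer.Theorems.SylvesterTwoHeegnerIndexCMHalfBottomClass
import HarnessLib

/-!
# The COUPLED Cassels–Tate telescope, RESIDUE 7′ (VARIANT Q): the HALVED BOTTOM LINK (crux `UpperOffV0HSYPlus`,
# stmt-BirchSwinnertonDyer-19804) — `2^{M₀} • δ(x₀)` versus the bottom class OF THE HALVED SYSTEM, inside `T_B(λ)`,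
# at `p ≡ 7 (mod 9)`

Skeleton VARIANT Q `Cruxes/UpperOffV0HSYPlus/Lines/coupled_variantQ.lean` d342db51dc602551, stub `stub_residueSevenHalved`
(RESIDUE 7′; planner D762 (3) «the halved bottom link (its own (G-a))», D793).  S3 `bottomLink_sylvesterPair`
(`…CoupledTelescopeBottomLink`, p739051) links, at `p ≡ 4 (9)`, the rows' bottom class `cB 1 := 2^{M₀} • δ(x₀)`
(`Y^tr = 2^{M₀} x₀ + T`, ANONYMOUS `Y`) to the CM-frame bottom class `c(ψ_B(Σᵢ ρ_{tᵢ}(tᵢ • κ⁻¹ ι y₁)))` over the FULL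
transversal of `Γ_K/N₀` through a `2`-adic unit of `𝒪 = ℤ[ω]`.  Here, at `p ≡ 7 (9)`, BOTH sides are HALVED: the rows'
provenance reads `Y^tr = 2 • (2^{M₀} x₀ + T)` (H-C `provenance_halved_sylvesterPair`), so `2^{M₀} • δ(x₀) = δ(Y″)`,
`Y″ := 2^{M₀} x₀ + T`, `2 • Y″ = Y^tr`; and the CM-frame bottom class of the HALVED system is the class of the HALF
χ-sum `ψ_B(Σ_{(q,h′) ∈ (𝒢₀⧸H) × H′} ρ_{t(q,h′)}(t(q,h′) • κ⁻¹ ι y₁))`, which is `[𝒢₀:H] • δ(Y′) + δ(T₀′)` for the HALF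
POINT `Y′`, `2 • Y′ = Y₁` (HSY's named point), by CMHalf #S2 `half_bottom_chiComponent_eq_toGeomPoints` ((G-a)′) — `Y′`
and its display AT EXPONENT `0` being CMHalf #S1 `exists_halfPoint_of_named_of_thmC` (the named display #19 at
`p ≡ 7 (9)`, exponent `−2`, halved by THEOREM C).  Then S3's `2`-adic comparison runs VERBATIM on `(Y″, Y′)` in place of
`(Y^tr, Y₁)`: both lie on the `K`-line of the generator `P″` with ODD denominators, both display identities read
`#Ш_an·#Ш_an = N(a + bω)/n²` AT EXPONENT `0` (`ĥ(2X) = 4ĥ(X)` absorbs the `2^{−2}`), so the `2`-adic exponents agree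
(`two_pow_exponent_eq`) and odd-norm elements of `𝒪` act invertibly on `T_B(λ)` (k-ty1 #43′).
* ★ `bottomLink_halved_sylvesterPair` — under RESIDUE 7′'s bottom binders (`p ≡ 7 (9)`, `Y^tr = 2 • (2^{M₀} • x₀ + T)`),
  THEOREM C (`hC`, = `thmC_closed hF` in the skeleton), the print inputs of `stub_printInputsTwo` (`Dt` of degree 6, the
  NAMED display #19), the frame/transversal data of the class system AND the bottom involution datum (`s ∈ H` with
  `s·y₁ = y₁` — (W2-b) at `n = 1`, displayed — and a half `H′` of `H`):
  `c • (2^{M₀} • δ x₀) ∈ T_B(v) ↔ c • c′_B^{(1)} ∈ T_B(v)` for every finite place `v` and every `c : ℤ`, `c′_B^{(1)}` the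
  class of the HALF χ-sum in ANY admissible module containing it.
Theorems only (no definition / named fact / instance / notation); CONDITIONAL on THEOREM C and the displayed involution
datum; nothing asserted on 19804; no stub closed on the ledger; X12.CMAtTwo NOT proved; BSD not claimed for any curve.
Sources: [GrossLMS1991] §4 (4.4), §5 (5.1); [McCallumLMS1991] §5; [HuShuYin2019] §2 Prop. 2.4, §3 p. 8, §4.1, p. 12 (bsd),
Thm. C; [IrelandRosen1990] Ch. 9 §1.  `lean search 'bottomLink_halved'` → nothing before this file.
-/

-- every Summits module is named `Summit.<Summit>.<Problem>…`: the duplicated component is by design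
set_option linter.dupNamespace false
set_option autoImplicit false

noncomputable section

open scoped Classical

open WeierstrassCurve WeierstrassCurve.Affine WeierstrassCurve.Affine.Point NumberField IsDedekindDomain
  Literature.NumberTheory.EllipticCurves Literature.NumberTheory.EllipticCurves.HuShuYin2019
  Literature.NumberTheory.EllipticCurves.KolyvaginCocycle Literature.NumberTheory.QuadraticFields
  Literature.NumberTheory.EllipticCurves.ModularForms

namespace Summit.BirchSwinnertonDyer.BirchSwinnertonDyer.Theorems.SylvesterTwoCoupledTelescope

open Summit.BirchSwinnertonDyer.BirchSwinnertonDyer.Theorems.SylvesterTwoCMNormForm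
  Summit.BirchSwinnertonDyer.BirchSwinnertonDyer.Theorems.SylvesterTwoCoupledDescentPrimitivity
  Summit.BirchSwinnertonDyer.BirchSwinnertonDyer.Theorems.SylvesterTwoCMFlip
  Summit.BirchSwinnertonDyer.BirchSwinnertonDyer.Theorems.SylvesterTwoCMHalf
  Summit.BirchSwinnertonDyer.BirchSwinnertonDyer.Theorems.SylvesterTwoFrame
  Summit.BirchSwinnertonDyer.BirchSwinnertonDyer.Theses.SylvesterTwoHeegnerIndex

variable {K : Type} [Field K] [NumberField K]

set_option maxHeartbeats 1600000 in
/-- ★ **THE HALVED BOTTOM LINK** (RESIDUE 7′, FLIP(ℓ, 1) read on the rows' `cB 1 := 2^{M₀} • δ(x₀)` with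
`Y^tr = 2 • (2^{M₀} • x₀ + T)`): for the HSY pair at `p ≡ 7 (9)`, a minimal model `B` with `CB • B = E_p`, the RESIDUE's
generator `P` and ANONYMOUS `Y` with the display (exponent `−2`), THEOREM C, any `M₀, x₀, T` with `T` torsion and
`Y^tr = 2 • (2^{M₀} • x₀ + T)`, the NAMED display #19 at a degree-6 `Dt`, the coupled frame, the product transversal `t`
of `Γ_K/N₀`, the bottom involution datum (`s ∈ H`, `s·y₁ = y₁`, a half `H′`), and the display's `φ_B`/`fn_B`: for every
finite place `v`, every `c : ℤ`, and the CM-frame class of the HALF bottom χ-component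
`ψ_B(Σ_{(q,h′) ∈ (𝒢₀⧸H) × H′} ρ_{t(q,h′)}(t(q,h′) • κ⁻¹ ι y₁))` in ANY admissible module containing it,
`c • (2^{M₀} • δ x₀) ∈ T_B(v) ↔ c • c′_B^{(1)} ∈ T_B(v)`. [cite: GrossLMS1991, §4 (4.4), §5 (5.1)]
[cite: HuShuYin2019, §2 Prop. 2.4, §3 p. 8, §4.1, p. 12 (bsd), Thm. C] [cite: McCallumLMS1991, §5] -/
theorem bottomLink_halved_sylvesterPair (hF : PublishedFactsTwoPlus)
    (hD : shaAnPair_mul_height_eq_two_zpow_mul_height_named)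
    (hC : SylvesterTwoNonneg.HSYPointTwoDivisibleSevenModNine)
    {p : ℕ} (hp : p.Prime) (h9 : p % 9 = 7) (h3 : ¬ ∃ x : ZMod p, x ^ 3 = 3)
    (A B : WeierstrassCurve ℚ) [A.IsElliptic] [A.IsGloballyMinimal] [B.IsElliptic] [B.IsGloballyMinimal]
    (hA : ∃ C : VariableChange ℚ, C • A = HuShuYin2019.cubeSumCurve (3 * (p : ℚ) ^ 2))
    (qB qA : ℚ) (hqB : shaAn B = (qB : ℂ)) (hqA : shaAn A = (qA : ℂ)) (hne : qB * qA ≠ 0)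
    {ω : K} (hω : ω ^ 2 + ω + 1 = 0) (h2 : Module.finrank ℚ K = 2)
    (CB : VariableChange ℚ) (hCB : CB • B = HuShuYin2019.cubeSumCurve (p : ℚ))
    (P : B.toAffine.Point) (Y : (B.baseChange K).toAffine.Point)
    (hPinf : ¬ IsOfFinAddOrder (WeierstrassCurve.QuadraticDescent.incl K B P))
    (hPgen : ∀ Q : B.toAffine.Point, ∃ m : ℤ, IsOfFinAddOrder
      (WeierstrassCurve.QuadraticDescent.incl K B Q - m • WeierstrassCurve.QuadraticDescent.incl K B P))
    (hht : ((qB * qA : ℚ) : ℝ) * canonicalHeight (WeierstrassCurve.QuadraticDescent.incl K B P) =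
      (2 : ℝ) ^ (if p % 9 = 4 then (0 : ℤ) else -2) * canonicalHeight Y)
    {M₀ : ℕ} {x₀ T : ((cubeSumCurve (p : ℚ)).baseChange K).toAffine.Point} (hT : IsOfFinAddOrder T)
    (hY : Affine.Point.congrEquiv (congrArg (fun W : WeierstrassCurve ℚ ↦ W.baseChange K) hCB)
      (VariableChange.pointEquivBaseChange B CB K Y) = (2 : ℤ) • (((2 ^ M₀ : ℕ) : ℤ) • x₀ + T))
    -- the level
    {M : ℕ} (nl : ℕ) (hn : nl = 2 ^ M)
    (hdiv : ∀ X : geomPoints ((cubeSumCurve (p : ℚ)).baseChange K),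
      ∃ R : geomPoints ((cubeSumCurve (p : ℚ)).baseChange K), ((nl : ℕ) : ℤ) • R = X)
    -- HSY's bottom point at a degree-6 parametrisation, the embedded `K[9p]`, the cube roots, the stabiliser
    (ι : K →+* ℂ) (Dt : ModularParametrizationData (⟨0, 0, 1, 0, -1⟩ : WeierstrassCurve ℚ) 243) (hdeg : Dt.deg = 6)
    (y₁ : ((⟨0, 0, 1, 0, -1⟩ : WeierstrassCurve ℚ).baseChange (ringClassField K ι (9 * p))).toAffine.Point)
    (hy₁ : Affine.Point.map (W' := (⟨0, 0, 1, 0, -1⟩ : WeierstrassCurve ℚ))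
        (ringClassField K ι (9 * p)).subtype.toRatAlgHom y₁ =
      Dt.φ (heegnerTau (81 * ((p : ℤ) ^ 2 + 4 * p + 16), -(9 * (4 * (p : ℤ) ^ 2 + 17 * p + 72)),
        4 * (p : ℤ) ^ 2 + 18 * p + 81)))
    (emb : ringClassField K ι (9 * p) →+* AlgebraicClosure K)
    (hemb : ∀ k : K, emb (algebraMap K (ringClassField K ι (9 * p)) k) = algebraMap K (AlgebraicClosure K) k)
    (ιpt : letI : DecidableEq (ringClassField K ι (9 * p)) := fun a b ↦ Classical.propDecidable (a = b)
      ((⟨0, 0, 1, 0, -1⟩ : WeierstrassCurve ℚ).baseChange (ringClassField K ι (9 * p))).toAffine.Point →+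
        geomPoints (((⟨0, 0, 1, 0, -1⟩ : WeierstrassCurve ℚ)).baseChange K))
    (hιpt : ∀ Q, ιpt Q = Affine.Point.map (W' := (⟨0, 0, 1, 0, -1⟩ : WeierstrassCurve ℚ)) emb.toRatAlgHom Q)
    (N₀ : Subgroup (Field.absoluteGaloisGroup K))
    (hN₀ : ∀ g : Field.absoluteGaloisGroup K, g ∈ N₀ ↔
      ∀ x : ringClassField K ι (9 * p), (show AlgebraicClosure K ≃ₐ[K] AlgebraicClosure K from g) (emb x) = emb x)
    {c₃ cp : ringClassField K ι (9 * p)} (hc₃ : c₃ ^ 3 = 3) (hcp : cp ^ 3 = (p : ringClassField K ι (9 * p)))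
    (H : Subgroup (ringClassField K ι (9 * p) ≃ₐ[K] ringClassField K ι (9 * p)))
    (hH : ∀ σ, σ ∈ H ↔ σ c₃ = c₃ ∧ σ cp = cp)
    [Fintype ((ringClassField K ι (9 * p) ≃ₐ[K] ringClassField K ι (9 * p)) ⧸ H)] [Fintype H]
    (Tl : (ringClassField K ι (9 * p) ≃ₐ[K] ringClassField K ι (9 * p)) → Field.absoluteGaloisGroup K)
    (hTl : ∀ σ (x : ringClassField K ι (9 * p)),
      (show AlgebraicClosure K ≃ₐ[K] AlgebraicClosure K from Tl σ) (emb x) = emb (σ x))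
    (t : ((ringClassField K ι (9 * p) ≃ₐ[K] ringClassField K ι (9 * p)) ⧸ H) × H → Field.absoluteGaloisGroup K)
    (ht' : ∀ q h, t (q, h) = Tl (Quotient.out q) * Tl (h : _))
    (ht : Function.Bijective fun i ↦ (t i : Field.absoluteGaloisGroup K ⧸ N₀))
    -- THE BOTTOM INVOLUTION DATUM ((W2-b) at `n = 1`; displayed, not proved): `s ∈ H`, `s · y₁ = y₁`, a half `H′` of `H`
    (s : H) (H' : Finset H) (hH' : ∀ h : H, Xor (h ∈ H') (h * s ∈ H'))
    (hsy : pointGalHom (⟨0, 0, 1, 0, -1⟩ : WeierstrassCurve ℚ) (ringClassField K ι (9 * p))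
      ((s : _ ≃ₐ[K] _).restrictScalars ℚ) y₁ = y₁)
    -- the frame transport (pinned) and the `B`-side of the coupled frame
    (κ : geomPoints ((cubeSumCurve 9).baseChange K) ≃+ geomPoints ((⟨0, 0, 1, 0, -1⟩ : WeierstrassCurve ℚ).baseChange K))
    (hκG : ∀ (g : Field.absoluteGaloisGroup K) (P : geomPoints ((cubeSumCurve 9).baseChange K)), κ (g • P) = g • κ P)
    (hκ : ∀ {x y : AlgebraicClosure K}
      (h : (((cubeSumCurve (9 : ℚ)).baseChange K).baseChange (AlgebraicClosure K)).toAffine.Nonsingular x y),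
      ∃ h', κ (Affine.Point.some x y h) = Affine.Point.some (x / 36) ((y - 108) / 216) h')
    {vB : AlgebraicClosure K} (hvBc : vB ^ 3 = algebraMap ℚ (AlgebraicClosure K) ((p : ℚ) / 9)) (hvB : vB ≠ 0)
    (hvB3 : ∀ g : Field.absoluteGaloisGroup K, ((show AlgebraicClosure K ≃ₐ[K] AlgebraicClosure K from g) vB) ^ 3 = vB ^ 3)
    {ψB : geomPoints ((cubeSumCurve 9).baseChange K) ≃+ geomPoints ((cubeSumCurve (p : ℚ)).baseChange K)}
    (hψB : ∀ {x y : AlgebraicClosure K}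
      (h : (((cubeSumCurve 9).baseChange K).baseChange (AlgebraicClosure K)).toAffine.Nonsingular x y),
      ∃ h', ψB (Affine.Point.some x y h) = Affine.Point.some (vB ^ 2 * x) (vB ^ 3 * y) h')
    {ρ : Field.absoluteGaloisGroup K →
      geomPoints ((cubeSumCurve 9).baseChange K) ≃+ geomPoints ((cubeSumCurve 9).baseChange K)}
    (hρ : ∀ (g : Field.absoluteGaloisGroup K) {x y : AlgebraicClosure K}
        (h : (((cubeSumCurve 9).baseChange K).baseChange (AlgebraicClosure K)).toAffine.Nonsingular x y),
        ∃ h', ρ g (Affine.Point.some x y h) =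
          Affine.Point.some (((show AlgebraicClosure K ≃ₐ[K] AlgebraicClosure K from g) vB / vB) ^ 2 * x) y h')
    (hlawB : ∀ (g : Field.absoluteGaloisGroup K) (P : geomPoints ((cubeSumCurve 9).baseChange K)),
        g • ψB P = ψB (ρ g (g • P)))
    (hρcomm : ∀ (g h : Field.absoluteGaloisGroup K) (P : geomPoints ((cubeSumCurve 9).baseChange K)),
        h • ρ g P = ρ g (h • P))
    -- the display's CM operator on `B_K` and its restriction to `B_K[nl]`
    (φB : Isogeny ((cubeSumCurve (p : ℚ)).baseChange K) ((cubeSumCurve (p : ℚ)).baseChange K))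
    (fnB : geomTorsion ((cubeSumCurve (p : ℚ)).baseChange K) ((nl : ℕ) : ℤ) →+
      geomTorsion ((cubeSumCurve (p : ℚ)).baseChange K) ((nl : ℕ) : ℤ))
    (hfnB : ∀ (g : Field.absoluteGaloisGroup K) (Q : geomTorsion ((cubeSumCurve (p : ℚ)).baseChange K) ((nl : ℕ) : ℤ)),
      fnB (ContinuousMonoidHom.id _ g • Q) = g • fnB Q)
    (hφB : ∀ (x y : AlgebraicClosure K)
      (h : (((cubeSumCurve (p : ℚ)).baseChange K).baseChange (AlgebraicClosure K)).toAffine.Nonsingular x y),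
      ∃ h', φB (Affine.Point.some x y h) =
        Affine.Point.some (algebraMap K (AlgebraicClosure K) ω ^ 2 * x) (algebraMap K (AlgebraicClosure K) ω ^ 3 * y) h')
    (hcoeB : ∀ Q : geomTorsion ((cubeSumCurve (p : ℚ)).baseChange K) ((nl : ℕ) : ℤ),
      ((fnB Q : geomTorsion ((cubeSumCurve (p : ℚ)).baseChange K) ((nl : ℕ) : ℤ)) :
        geomPoints ((cubeSumCurve (p : ℚ)).baseChange K)) = φB Q)
    -- the bottom class in any admissible module containing its point
    {A₁ : AddSubgroup (geomPoints ((cubeSumCurve (p : ℚ)).baseChange K))}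
    (hA₁ : IsAdmissible (Field.absoluteGaloisGroup K) A₁ ((nl : ℕ) : ℤ))
    (hP₁ : ψB (∑ i : ((ringClassField K ι (9 * p) ≃ₐ[K] ringClassField K ι (9 * p)) ⧸ H) × H',
        ρ (t (i.1, (i.2 : H))) (t (i.1, (i.2 : H)) • κ.symm (ιpt y₁))) ∈
      invPoints (Field.absoluteGaloisGroup K) A₁ ((nl : ℕ) : ℤ))
    (v : HeightOneSpectrum (𝓞 K)) (c : ℤ) :
    c • (((2 : ℤ) ^ M₀) • kummerMapTorsion ((cubeSumCurve (p : ℚ)).baseChange K) ((nl : ℕ) : ℤ) hdiv x₀) ∈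
        ((cubeSumCurve (p : ℚ)).baseChange K).torsionLocalKer (v.adicCompletion K) ((nl : ℕ) : ℤ) ↔
      c • kolyvaginClass ((cubeSumCurve (p : ℚ)).baseChange K) ((nl : ℕ) : ℤ) hdiv hA₁
          (ψB (∑ i : ((ringClassField K ι (9 * p) ≃ₐ[K] ringClassField K ι (9 * p)) ⧸ H) × H',
        ρ (t (i.1, (i.2 : H))) (t (i.1, (i.2 : H)) • κ.symm (ιpt y₁)))) hP₁ ∈
        ((cubeSumCurve (p : ℚ)).baseChange K).torsionLocalKer (v.adicCompletion K) ((nl : ℕ) : ℤ) := by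
  subst hn
  have hp2 : p ≠ 2 := by rintro rfl; norm_num at h9
  have h94 : ¬ p % 9 = 4 := by omega
  have hp0 : p ≠ 0 := hp.ne_zero
  have hp0' : (p : ℚ) ≠ 0 := by exact_mod_cast hp0
  have hpodd : Odd p := hp.eq_two_or_odd'.resolve_left hp2
  have hK := JZero.isImaginaryQuadratic_of_sq_add_self_add_one hω h2
  have hζ : IsPrimitiveRoot ω 3 := (JZero.exists_aut_apply_eq_sq K hω h2).1
  have hB : ∃ C : VariableChange ℚ, C • B = HuShuYin2019.cubeSumCurve (p : ℚ) := ⟨CB, hCB⟩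
  haveI hB₀ : ((cubeSumCurve (p : ℚ)).baseChange K).IsElliptic := isElliptic_cubeSumCurve_baseChange K hp0'
  haveI hBK : (B.baseChange K).IsElliptic := inferInstanceAs (B.map (algebraMap ℚ K)).IsElliptic
  -- ### the short model `B₀ = E_p ⊗ K`: `a₁ = a₂ = a₃ = a₄ = 0`, the CM rotation `θ`, no `2`-torsion
  have ha1 : ((cubeSumCurve (p : ℚ)).baseChange K).a₁ = 0 := by simp [cubeSumCurve, WeierstrassCurve.baseChange]
  have ha2 : ((cubeSumCurve (p : ℚ)).baseChange K).a₂ = 0 := by simp [cubeSumCurve, WeierstrassCurve.baseChange]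
  have ha3 : ((cubeSumCurve (p : ℚ)).baseChange K).a₃ = 0 := by simp [cubeSumCurve, WeierstrassCurve.baseChange]
  have ha4 : ((cubeSumCurve (p : ℚ)).baseChange K).a₄ = 0 := by simp [cubeSumCurve, WeierstrassCurve.baseChange]
  obtain ⟨θ, hθ⟩ := exists_omegaRot (W := (cubeSumCurve (p : ℚ)).baseChange K) hω ha1 ha2 ha3 ha4
  have hθ0 : (θ : _ → _) 0 = 0 := map_zero θ
  have hθ3 : ∀ X, θ.toAddMonoidHom (θ.toAddMonoidHom X) + θ.toAddMonoidHom X + X = 0 := fun X ↦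
    omegaRot_omegaRot_add_omegaRot_add hω ha1 ha2 ha3 ha4 hθ0 hθ (omega_ne_one hω) X
  have h2tor : ∀ X : ((cubeSumCurve (p : ℚ)).baseChange K).toAffine.Point, 2 • X = 0 → X = 0 :=
    two_torsion_eq_zero_cubeSumCurve_of_finrank_eq_two K h2 hp hp2
  -- ### the transport `e : B(K) ≃ B₀(K)`, the generator `P″`, heights
  set φv := VariableChange.pointEquivBaseChange B CB K with hφv
  set ψc := Affine.Point.congrEquiv (congrArg (fun W : WeierstrassCurve ℚ ↦ W.baseChange K) hCB) with hψc
  have hhe : ∀ X, canonicalHeight (ψc (φv X)) = canonicalHeight X := fun X ↦ by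
    rw [hψc, canonicalHeight_congrEquiv, hφv, canonicalHeight_pointEquivBaseChange]
  obtain ⟨P'', hP''⟩ : ∃ P'' : ((cubeSumCurve (p : ℚ)).baseChange K).toAffine.Point,
      P'' = ψc (φv (QuadraticDescent.incl K B P)) := ⟨_, rfl⟩
  have hP''inf : ¬ IsOfFinAddOrder P'' := fun h ↦ by
    rw [hP''] at h
    exact hPinf ((φv.trans ψc).injective.isOfFinAddOrder_iff (f := (φv.trans ψc).toAddMonoidHom) |>.mp h)
  -- ### `P″ ∉ 2 B₀(K) + tors` ((T6)'s descent along the conjugation of `K/ℚ`, on `(CB • B)_K`, transported)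
  haveI hCBK : ((CB • B).baseChange K).IsElliptic := inferInstanceAs ((CB • B).map (algebraMap ℚ K)).IsElliptic
  obtain ⟨θ₀, cc, hθ₀, hcc⟩ := Quadratic.exists_sq_eq_algebraMap (F := ℚ) (K := K) h2
  have h2tor' : ∀ X : ((CB • B).baseChange K).toAffine.Point, 2 • X = 0 → X = 0 :=
    two_torsion_eq_zero_of_model_of_finrank_eq_two K h2 hp hp2 (CB • B) ⟨1, by rw [one_smul, hCB]⟩
  have hσσ : ∀ X, WeierstrassCurve.QuadraticDescent.conjMap (CB • B) (Quadratic.conj h2 hθ₀ hcc)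
      (WeierstrassCurve.QuadraticDescent.conjMap (CB • B) (Quadratic.conj h2 hθ₀ hcc) X) = X :=
    WeierstrassCurve.QuadraticDescent.conjMap_conjMap (CB • B) (Quadratic.conj_conj h2 hθ₀ hcc)
  have hσP : WeierstrassCurve.QuadraticDescent.conjMap (CB • B) (Quadratic.conj h2 hθ₀ hcc)
      (φv (QuadraticDescent.incl K B P)) = φv (QuadraticDescent.incl K B P) := by
    rw [hφv]
    show Affine.Point.map _ (VariableChange.pointEquivBaseChange B CB K _) = _
    rw [VariableChange.pointEquivBaseChange_map]
    exact congrArg (VariableChange.pointEquivBaseChange B CB K)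
      (WeierstrassCurve.QuadraticDescent.conjMap_incl B (Quadratic.conj h2 hθ₀ hcc) P)
  have hPinf' : ¬ IsOfFinAddOrder (φv (QuadraticDescent.incl K B P)) := fun h ↦
    hPinf ((φv.injective.isOfFinAddOrder_iff (f := φv.toAddMonoidHom)).mp h)
  have hP2' : ¬ ∃ (Q T' : ((CB • B).baseChange K).toAffine.Point), IsOfFinAddOrder T' ∧
      φv (QuadraticDescent.incl K B P) = 2 • Q + T' :=
    not_exists_eq_two_smul_add_torsion
      (WeierstrassCurve.QuadraticDescent.conjMap (CB • B) (Quadratic.conj h2 hθ₀ hcc)) hσσ h2tor' hPinf' hσP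
      (fun X hX ↦ descends_of_generator h2 hθ₀ hcc B CB hPgen X hX)
  have hP2 : ¬ ∃ (Q T' : ((cubeSumCurve (p : ℚ)).baseChange K).toAffine.Point), IsOfFinAddOrder T' ∧ P'' = 2 • Q + T' := by
    rintro ⟨Q, T', hT', hQ⟩
    refine hP2' ⟨ψc.symm Q, ψc.symm T', ψc.symm.toAddMonoidHom.isOfFinAddOrder hT', ?_⟩
    apply ψc.injective
    rw [map_add, map_nsmul, ψc.apply_symm_apply, ψc.apply_symm_apply, ← hQ, hP'']
  -- ### rank 2; HSY's named point `Y₁`, its HALF `Yh` (THEOREM C) with the display AT EXPONENT 0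
  obtain ⟨-, -, -, -, -, hrank, -⟩ := hF.2 p hp (Or.inr h9) h3 A B hB hA K ω hω h2
  have hr : Module.finrank ℤ ((cubeSumCurve (p : ℚ)).baseChange K).toAffine.Point = 2 := by
    rw [← (φv.trans ψc).toIntLinearEquiv.finrank_eq]; exact hrank
  haveI : (⟨0, 0, 1, 0, -1⟩ : WeierstrassCurve ℚ).IsElliptic := isElliptic_sylvesterNineMinimal
  obtain ⟨T₃, hT₃, Y₁, Yh, hY₁, -, h2Yh, hdisp⟩ := exists_halfPoint_of_named_of_thmC hω h2 ι hD hC Dt hdeg hp h9 h3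
    κ hκG hκ hvBc hvB hvB3 hψB hρ hlawB emb hemb ιpt hιpt N₀ hN₀ hc₃ hcp H hH s H' hH' y₁ hy₁ hsy
  obtain ⟨P₁, Y', hP₁inf, hP₁gen, hht₁, hY'tr⟩ := hdisp A B CB hCB hA qB qA hqB hqA
  -- ### the HALF bottom χ-component is `ι([𝒢:H] • Yh + T₀)`
  obtain ⟨T₀, hT₀, hbot⟩ := half_bottom_chiComponent_eq_toGeomPoints hω h2 ι hp0 hpodd κ hκG hvBc hvB hvB3 hψB hρ
    hlawB hρcomm emb hemb ιpt hιpt N₀ hN₀ hc₃ hcp H hH Tl hTl t ht' ht s H' hH' y₁ T₃ hsy hT₃ Y₁ Yh hY₁ h2Yh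
  have hT₀fin : IsOfFinAddOrder T₀ :=
    isOfFinAddOrder_iff_zsmul_eq_zero.mpr ⟨3, by norm_num, hT₀⟩
  haveI := (finiteDimensional_and_isGalois_ringClassField hK ι (mul_ne_zero (by norm_num) hp0 : 9 * p ≠ 0)).1
  have hmodd : Odd ((Fintype.card ((ringClassField K ι (9 * p) ≃ₐ[K] ringClassField K ι (9 * p)) ⧸ H) : ℤ)) := by
    have h := odd_card_quotient_stabilizer (K := K) hω hc₃ hp0 hcp H hH
    rw [Nat.card_eq_fintype_card] at h
    exact_mod_cast h
  -- ### the rows' HALF point `Y″ := 2^{M₀} • x₀ + T`, `2 • Y″ = Y^tr`, its display AT EXPONENT 0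
  set Y'' : ((cubeSumCurve (p : ℚ)).baseChange K).toAffine.Point := ((2 ^ M₀ : ℕ) : ℤ) • x₀ + T with hY''def
  have h2Y'' : ψc (φv Y) = (2 : ℤ) • Y'' := hY
  have hidY'' : ((qB * qA : ℚ) : ℝ) * canonicalHeight (QuadraticDescent.incl K B P) =
      (2 : ℝ) ^ (0 : ℤ) * canonicalHeight Y'' := by
    rw [hht, if_neg h94, ← hhe Y, h2Y'', canonicalHeight_zsmul_holds, zpow_zero, one_mul]
    push_cast
    rw [zpow_neg, ← mul_assoc, show ((2 : ℝ) ^ (2 : ℤ))⁻¹ * (2 : ℝ) ^ 2 = 1 by norm_num, one_mul]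
  -- ### the Kummer map `δ`, the operator `w_B = H¹(fn_B)`, `w² + w + 1 = 0`, local points maps
  have hrelB : ∀ Q, fnB (fnB Q) + fnB Q + Q = 0 := JZero.torsion_hrel_of_formula
    (SylvesterTwoCoupledDescentF4Package.baseChange_eq_of_a_eq_zero (K := K) (cubeSumCurve (p : ℚ)) rfl rfl rfl rfl)
    hζ φB hφB _ fnB hcoeB
  have hrel := resH1Hom_id_apply_apply_add _ fnB hfnB hrelB
  have hloc := φB.hasLocalPointsMaps_toAddMonoidHom
  have hmt : ∀ t : galH1Torsion ((cubeSumCurve (p : ℚ)).baseChange K) (((2 ^ M : ℕ) : ℤ)), (((2 ^ M : ℕ) : ℤ)) • t = 0 :=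
    fun t ↦ zsmul_galH1Torsion_eq_zero _ _ t
  have hdvd : (((2 ^ M : ℕ) : ℤ)) ∣ (2 : ℤ) ^ M := by push_cast; exact dvd_rfl
  have hδtor : ∀ {X : ((cubeSumCurve (p : ℚ)).baseChange K).toAffine.Point}, IsOfFinAddOrder X →
      kummerMapTorsion ((cubeSumCurve (p : ℚ)).baseChange K) (((2 ^ M : ℕ) : ℤ)) hdiv X = 0 := fun hX ↦
    kummerMapTorsion_eq_zero_of_isOfFinAddOrder h2 hp hp2 (2 ^ M) rfl hdiv hX
  have hδθ : ∀ Q, kummerMapTorsion ((cubeSumCurve (p : ℚ)).baseChange K) (((2 ^ M : ℕ) : ℤ)) hdiv (θ Q) =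
      -kummerMapTorsion ((cubeSumCurve (p : ℚ)).baseChange K) (((2 ^ M : ℕ) : ℤ)) hdiv Q -
        resH1Hom (ContinuousMonoidHom.id _) fnB hfnB (kummerMapTorsion ((cubeSumCurve (p : ℚ)).baseChange K) (((2 ^ M : ℕ) : ℤ)) hdiv Q) :=
    kummerMapTorsion_omegaRot hω ha1 ha2 ha3 ha4 _ φB.toAddMonoidHom φB.equivariant hφB fnB hfnB hcoeB hrel hdiv hθ0 hθ
  -- ### both HALF points on the `K`-line of `P″` with ODD denominators, and the two height identities (exponent 0)
  obtain ⟨n₀, a₀, b₀, hn₀, hY₀⟩ := exists_zsmul_eq_of_finrank_eq_two hω ha1 ha2 ha3 ha4 hθ0 hθ hr hP''inf Y''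
  obtain ⟨n, a, b, T', hodd, hT', hYn⟩ := exists_odd_zsmul_eq θ.toAddMonoidHom hθ3 P'' hP2
    n₀.natAbs le_rfl hn₀ IsOfFinAddOrder.zero hY₀
  have hn : n ≠ 0 := by rintro rfl; exact hodd ⟨0, rfl⟩
  have hid : ((qB * qA : ℚ) : ℝ) * canonicalHeight P'' = (2 : ℝ) ^ (0 : ℤ) * canonicalHeight Y'' := by
    rw [hP'', hhe, hidY'']
  obtain ⟨hab, hqe⟩ := eq_two_zpow_mul_norm_div_sq_of_height_identity hω ha1 ha2 ha3 ha4 hθ0 hθ hP''inf hT' hn hYn hne hid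
  obtain ⟨n₁, a₁, b₁, hn₁, hY₁₀⟩ := exists_zsmul_eq_of_finrank_eq_two hω ha1 ha2 ha3 ha4 hθ0 hθ hr hP''inf Yh
  obtain ⟨n', a', b', T'', hodd', hT'', hYn'⟩ := exists_odd_zsmul_eq θ.toAddMonoidHom hθ3 P'' hP2
    n₁.natAbs le_rfl hn₁ IsOfFinAddOrder.zero hY₁₀
  have hn' : n' ≠ 0 := by rintro rfl; exact hodd' ⟨0, rfl⟩
  have hid' : ((qB * qA : ℚ) : ℝ) * canonicalHeight P'' = (2 : ℝ) ^ (0 : ℤ) * canonicalHeight Yh := by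
    rw [hP'', hhe, ← canonicalHeight_incl_eq_of_generators B hPinf hPgen hP₁gen, ← hY'tr, hhe, hht₁]
  obtain ⟨hab', hqe'⟩ := eq_two_zpow_mul_norm_div_sq_of_height_identity hω ha1 ha2 ha3 ha4 hθ0 hθ hP''inf hT'' hn' hYn' hne hid'
  -- ### the `2`-adic split and `e = e'`
  obtain ⟨e, a'', b'', rfl, rfl, hab''⟩ := exists_two_pow_split _ a b le_rfl hab
  obtain ⟨e', c'', d'', rfl, rfl, hcd''⟩ := exists_two_pow_split _ a' b' le_rfl hab'
  have hodd₂ : ∀ {u v : ℤ}, ¬ (2 ∣ u ∧ 2 ∣ v) → Odd (u ^ 2 - u * v + v ^ 2) := by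
    intro u v h
    refine (EisensteinModule.odd_norm_iff u v).mpr ?_
    rcases Int.even_or_odd u with hu | hu
    · right
      by_contra hv
      exact h ⟨even_iff_two_dvd.mp hu, even_iff_two_dvd.mp (Int.not_odd_iff_even.mp hv)⟩
    · exact Or.inl hu
  have hN : Odd (a'' ^ 2 - a'' * b'' + b'' ^ 2) := hodd₂ hab''
  have hN' : Odd (c'' ^ 2 - c'' * d'' + d'' ^ 2) := hodd₂ hcd''
  have hN₁ : Odd ((a'' - b'') ^ 2 - (a'' - b'') * (-b'') + (-b'') ^ 2) := by
    have e1 : (a'' - b'') ^ 2 - (a'' - b'') * (-b'') + (-b'') ^ 2 = a'' ^ 2 - a'' * b'' + b'' ^ 2 := by ring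
    rw [e1]; exact hN
  have hN₁' : Odd ((c'' - d'') ^ 2 - (c'' - d'') * (-d'') + (-d'') ^ 2) := by
    have e1 : (c'' - d'') ^ 2 - (c'' - d'') * (-d'') + (-d'') ^ 2 = c'' ^ 2 - c'' * d'' + d'' ^ 2 := by ring
    rw [e1]; exact hN'
  have hoddn : Odd n := Int.not_even_iff_odd.mp (fun h ↦ hodd (even_iff_two_dvd.mp h))
  have hoddn' : Odd n' := Int.not_even_iff_odd.mp (fun h ↦ hodd' (even_iff_two_dvd.mp h))
  have h4 : ∀ k : ℕ, (4 : ℤ) ^ k = (2 : ℤ) ^ k * (2 : ℤ) ^ k := fun k ↦ by rw [← mul_pow]; norm_num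
  have hee : e = e' := by
    have h := hqe.symm.trans hqe'
    rw [zpow_zero, one_mul, one_mul, div_eq_div_iff (pow_ne_zero 2 (by exact_mod_cast hn : (n : ℚ) ≠ 0))
      (pow_ne_zero 2 (by exact_mod_cast hn' : (n' : ℚ) ≠ 0))] at h
    have hZ : (((2 : ℤ) ^ e * a'') ^ 2 - (2 : ℤ) ^ e * a'' * ((2 : ℤ) ^ e * b'') + ((2 : ℤ) ^ e * b'') ^ 2) * n' ^ 2 =
        (((2 : ℤ) ^ e' * c'') ^ 2 - (2 : ℤ) ^ e' * c'' * ((2 : ℤ) ^ e' * d'') + ((2 : ℤ) ^ e' * d'') ^ 2) * n ^ 2 := by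
      exact_mod_cast h
    refine two_pow_exponent_eq hN hN' hoddn hoddn' ?_
    rw [h4, h4]
    linear_combination hZ
  -- ### the two classes on the `𝒪`-line of `δ P″`
  have hx : ((2 : ℤ) ^ M₀) • kummerMapTorsion ((cubeSumCurve (p : ℚ)).baseChange K) (((2 ^ M : ℕ) : ℤ)) hdiv x₀ =
      kummerMapTorsion ((cubeSumCurve (p : ℚ)).baseChange K) (((2 ^ M : ℕ) : ℤ)) hdiv Y'' := by
    rw [hY''def, map_add, hδtor hT, add_zero, map_zsmul]; push_cast; rfl
  have hnY : n • kummerMapTorsion ((cubeSumCurve (p : ℚ)).baseChange K) (((2 ^ M : ℕ) : ℤ)) hdiv Y'' =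
      (2 : ℤ) ^ e • ((a'' - b'') • kummerMapTorsion ((cubeSumCurve (p : ℚ)).baseChange K) (((2 ^ M : ℕ) : ℤ)) hdiv P'' +
        (-b'') • resH1Hom (ContinuousMonoidHom.id _) fnB hfnB
          (kummerMapTorsion ((cubeSumCurve (p : ℚ)).baseChange K) (((2 ^ M : ℕ) : ℤ)) hdiv P'')) := by
    rw [← map_zsmul, hYn, map_add, map_add, hδtor hT', add_zero, map_zsmul, map_zsmul]
    change _ + _ • kummerMapTorsion _ _ hdiv (θ P'') = _
    rw [hδθ, zsmul_sub, zsmul_neg, zsmul_add, ← mul_zsmul, ← mul_zsmul, mul_sub, sub_zsmul, mul_neg, neg_zsmul]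
    abel
  have hnY₁ : n' • kummerMapTorsion ((cubeSumCurve (p : ℚ)).baseChange K) (((2 ^ M : ℕ) : ℤ)) hdiv Yh =
      (2 : ℤ) ^ e' • ((c'' - d'') • kummerMapTorsion ((cubeSumCurve (p : ℚ)).baseChange K) (((2 ^ M : ℕ) : ℤ)) hdiv P'' +
        (-d'') • resH1Hom (ContinuousMonoidHom.id _) fnB hfnB
          (kummerMapTorsion ((cubeSumCurve (p : ℚ)).baseChange K) (((2 ^ M : ℕ) : ℤ)) hdiv P'')) := by
    rw [← map_zsmul, hYn', map_add, map_add, hδtor hT'', add_zero, map_zsmul, map_zsmul]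
    change _ + _ • kummerMapTorsion _ _ hdiv (θ P'') = _
    rw [hδθ, zsmul_sub, zsmul_neg, zsmul_add, ← mul_zsmul, ← mul_zsmul, mul_sub, sub_zsmul, mul_neg, neg_zsmul]
    abel
  have hcls : kolyvaginClass ((cubeSumCurve (p : ℚ)).baseChange K) (((2 ^ M : ℕ) : ℤ)) hdiv hA₁
      (ψB (∑ i : ((ringClassField K ι (9 * p) ≃ₐ[K] ringClassField K ι (9 * p)) ⧸ H) × H',
        ρ (t (i.1, (i.2 : H))) (t (i.1, (i.2 : H)) • κ.symm (ιpt y₁)))) hP₁ =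
      ((Fintype.card ((ringClassField K ι (9 * p) ≃ₐ[K] ringClassField K ι (9 * p)) ⧸ H) : ℤ)) •
        kummerMapTorsion ((cubeSumCurve (p : ℚ)).baseChange K) (((2 ^ M : ℕ) : ℤ)) hdiv Yh := by
    have key : ∀ {X : geomPoints ((cubeSumCurve (p : ℚ)).baseChange K)}
        (hX : X ∈ invPoints (Field.absoluteGaloisGroup K) A₁ (((2 ^ M : ℕ) : ℤ)))
        (eX : X = toGeomPoints ((cubeSumCurve (p : ℚ)).baseChange K)
          (((Fintype.card ((ringClassField K ι (9 * p) ≃ₐ[K] ringClassField K ι (9 * p)) ⧸ H) : ℤ)) • Yh + T₀)),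
        kolyvaginClass ((cubeSumCurve (p : ℚ)).baseChange K) (((2 ^ M : ℕ) : ℤ)) hdiv hA₁ X hX =
          ((Fintype.card ((ringClassField K ι (9 * p) ≃ₐ[K] ringClassField K ι (9 * p)) ⧸ H) : ℤ)) •
            kummerMapTorsion ((cubeSumCurve (p : ℚ)).baseChange K) (((2 ^ M : ℕ) : ℤ)) hdiv Yh := by
      intro X hX eX
      subst eX
      rw [kolyvaginClass_toGeomPoints hA₁, map_add, hδtor hT₀fin, add_zero, map_zsmul]
    exact key hP₁ hbot
  -- ### both memberships reduce to `(c * 2^e) • δ P″ ∈ T_B(v)`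
  have iffY : c • kummerMapTorsion ((cubeSumCurve (p : ℚ)).baseChange K) (((2 ^ M : ℕ) : ℤ)) hdiv Y'' ∈
      ((cubeSumCurve (p : ℚ)).baseChange K).torsionLocalKer (v.adicCompletion K) (((2 ^ M : ℕ) : ℤ)) ↔
      (c * 2 ^ e) • kummerMapTorsion ((cubeSumCurve (p : ℚ)).baseChange K) (((2 ^ M : ℕ) : ℤ)) hdiv P'' ∈
      ((cubeSumCurve (p : ℚ)).baseChange K).torsionLocalKer (v.adicCompletion K) (((2 ^ M : ℕ) : ℤ)) := by
    have h1 := zsmul_add_zsmul_resH1Hom_id_mem_torsionLocalKer_iff (((2 ^ M : ℕ) : ℤ)) (v.adicCompletion K) fnB hfnB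
      φB.toAddMonoidHom hcoeB hloc hrel
      (hmt (kummerMapTorsion ((cubeSumCurve (p : ℚ)).baseChange K) (((2 ^ M : ℕ) : ℤ)) hdiv Y'')) (a := n) (b := 0)
      (EisensteinModule.isCoprime_of_odd_of_dvd_two_pow (by simpa using hoddn.pow) hdvd) c
    rw [zero_smul, add_zero, hnY, smul_smul] at h1
    rw [← h1]
    exact zsmul_add_zsmul_resH1Hom_id_mem_torsionLocalKer_iff (((2 ^ M : ℕ) : ℤ)) (v.adicCompletion K) fnB hfnB
      φB.toAddMonoidHom hcoeB hloc hrel (hmt _) (EisensteinModule.isCoprime_of_odd_of_dvd_two_pow hN₁ hdvd) (c * 2 ^ e)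
  have iffY₁ : c • kolyvaginClass ((cubeSumCurve (p : ℚ)).baseChange K) (((2 ^ M : ℕ) : ℤ)) hdiv hA₁
      (ψB (∑ i : ((ringClassField K ι (9 * p) ≃ₐ[K] ringClassField K ι (9 * p)) ⧸ H) × H',
        ρ (t (i.1, (i.2 : H))) (t (i.1, (i.2 : H)) • κ.symm (ιpt y₁)))) hP₁ ∈
      ((cubeSumCurve (p : ℚ)).baseChange K).torsionLocalKer (v.adicCompletion K) (((2 ^ M : ℕ) : ℤ)) ↔
      (c * 2 ^ e') • kummerMapTorsion ((cubeSumCurve (p : ℚ)).baseChange K) (((2 ^ M : ℕ) : ℤ)) hdiv P'' ∈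
      ((cubeSumCurve (p : ℚ)).baseChange K).torsionLocalKer (v.adicCompletion K) (((2 ^ M : ℕ) : ℤ)) := by
    rw [hcls]
    -- drop the odd index `[𝒢:H]`
    have h0 := zsmul_add_zsmul_resH1Hom_id_mem_torsionLocalKer_iff (((2 ^ M : ℕ) : ℤ)) (v.adicCompletion K) fnB hfnB
      φB.toAddMonoidHom hcoeB hloc hrel
      (hmt (kummerMapTorsion ((cubeSumCurve (p : ℚ)).baseChange K) (((2 ^ M : ℕ) : ℤ)) hdiv Yh))
      (a := ((Fintype.card ((ringClassField K ι (9 * p) ≃ₐ[K] ringClassField K ι (9 * p)) ⧸ H) : ℤ))) (b := 0)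
      (EisensteinModule.isCoprime_of_odd_of_dvd_two_pow (by simpa using hmodd.pow) hdvd) c
    rw [zero_smul, add_zero] at h0
    rw [h0]
    -- multiply by the odd `n'`
    have h1 := zsmul_add_zsmul_resH1Hom_id_mem_torsionLocalKer_iff (((2 ^ M : ℕ) : ℤ)) (v.adicCompletion K) fnB hfnB
      φB.toAddMonoidHom hcoeB hloc hrel
      (hmt (kummerMapTorsion ((cubeSumCurve (p : ℚ)).baseChange K) (((2 ^ M : ℕ) : ℤ)) hdiv Yh)) (a := n') (b := 0)
      (EisensteinModule.isCoprime_of_odd_of_dvd_two_pow (by simpa using hoddn'.pow) hdvd) c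
    rw [zero_smul, add_zero, hnY₁, smul_smul] at h1
    rw [← h1]
    exact zsmul_add_zsmul_resH1Hom_id_mem_torsionLocalKer_iff (((2 ^ M : ℕ) : ℤ)) (v.adicCompletion K) fnB hfnB
      φB.toAddMonoidHom hcoeB hloc hrel (hmt _) (EisensteinModule.isCoprime_of_odd_of_dvd_two_pow hN₁' hdvd) (c * 2 ^ e')
  rw [hx, iffY, iffY₁, hee]

end Summit.BirchSwinnertonDyer.BirchSwinnertonDyer.Theorems.SylvesterTwoCoupledTelescope

end
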